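import Literature.Topology.FourManifolds.OneOneTransversality
import Literature.Topology.FourManifolds.OneJetCriticalCurve
import Mathlib.Analysis.Calculus.Deriv.Mul
import Mathlib.Analysis.Calculus.Deriv.Comp
import Mathlib.Analysis.Calculus.Deriv.Prod
import Mathlib.Analysis.Calculus.Deriv.Add
import Mathlib.Analysis.Calculus.FDeriv.Symmetric
import HarnessLib

/-!
# Nondegenerate zeros of the incidence system of `S_{1,1}` are simple cusps

Topic `Literature/Topology/FourManifolds` (programme of the fact
`Literature.Topology.FourManifolds.exists_isSimplifiedBrokenLefschetzFibration`, Baykur–Saeki 2017, §2.1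
p. 6: a generic map `X⁴ → Σ²` has *"only fold and cusp singularities"*).
`OneOneTransversality.lean` proved that after almost every quadratic perturbation every zero
`u = (x, c, y, τ)` of the determinant-free incidence system `G` of `S_{1,1}` (critical point `x`
with cokernel covector `ℓ_c = ℓ_A + c ℓ_B`, radical direction `k = e_a + ∑ yᵢ e_{a↑i}` of the
kernel Hessian, multiplier `τ`) is NONDEGENERATE: `D_uG` is onto.  This file says what that
means for the map: the **invariant cubic**

  `c₃(u) = ℓ_c(D³g(x)(k, k, k)) + 3τ · ℓ_B(D²g(x)(k, k))`

does not vanish (`OneJet.cuspCubic_ne_zero_of_surjective`).  In rank-one fibred coordinates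
`g = (q₀, f)` the cubic is a non-zero multiple of `∂³f/∂k³` at the point, i.e. of `∂³h/∂x³(0)`
for the function `h` left after splitting off the nondegenerate part of the fibre Hessian — the
*simple cusp* condition of Whitney and Golubitsky–Guillemin (*Stable Mappings and Their
Singularities* (1973), Ch. VI §2, Def. 2.3 with p. 147: "the function `k|_{S₁(f)}` has a simple
zero"; §4–§5: `j²f ⋔ S_{1,1}`), the hypothesis of the Morin/Whitney normal form
`(t, x³ + tx ± y² ± z²)` (GG VI Thm. 2.4 in the plane).  The term `3τ ℓ_B D²g(k,k)` is what makes
the quantity independent of the source coordinates (at a zero, `ℓ_c D²g(σ''(k,k), k) =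
-τ ℓ_B dg(σ''(k,k))`).

* `OneJet.hasDerivAt_oneOneSystem_line`, `OneJet.fderiv_oneOneSystem_apply` — **the differential
  of the system in the unknowns** (product rules along lines; `g ∈ C^∞(Ω)`):
  `D_uG(v, ċ, ẏ, τ̇) = (ℓ_c D²g(v,·) + ċ ℓ_B dg, ℓ_c D³g(v,·,k) + ċ ℓ_B D²g(·,k) + ℓ_c D²g(·,k̇) +
  τ̇ ℓ_B dg + τ ℓ_B D²g(v,·), ℓ_B D²g(v,k) + ℓ_B dg(k̇))`, `k̇ = ∑ ẏᵢ e_{a↑i}`;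
* `OneJet.exists_kernel_vector` — the linear algebra: if `c₃(u) = 0` at a zero `u` of the system
  of a map 1-jet-transverse at `x`, then `(k, τ, ẏ, τ̇)` is a kernel vector of `D_uG` for a
  suitable `(ẏ, τ̇)` (the `(ẏ, τ̇)`-block of `D_uG` is injective by transversality, hence onto;
  the residual equation in the direction `k` IS `c₃(u) = 0`);
* **`OneJet.cuspCubic_ne_zero_of_surjective`** — `D_uG` onto ⇒ `c₃(u) ≠ 0` (`D_uG` is a square
  `9 × 9` matrix, so onto ⇒ injective, contradicting the kernel vector `k ≠ 0`);
* `OneJet.exists_chart_zero_of_radical` — conversely **every cusp candidate is a zero of one of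
  the eight systems**: a rank-one critical point `x` with cokernel covector `ℓ` and a non-zero
  radical vector `k₀` of the kernel Hessian gives a zero `(x, c, y, τ)` of the system in the
  charts `a` (`(k₀)_a ≠ 0`), `i` (`ℓ(eᵢ) ≠ 0`), the multiplier `τ` existing because
  `ℓ_c D²g(·, k)` vanishes on the hyperplane `Ker dg_x = Ker(e_{i+1}* ∘ dg_x)`;
* `OneJet.exists_chart_cuspCubic_ne_zero` — the two combined: **for a map that is
  1-jet-transverse at `x` and all of whose incidence systems have only nondegenerate zeros at
  `x` (the generic maps of `OneOneTransversality.exists_norm_lt_twoGeneric`), every cusp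
  candidate `(x, ℓ, k₀)` has non-vanishing invariant cubic** in the chart through `(ℓ, k₀)`.

Everything is proved; `radDir` (linear part of the chart of directions) and `cuspCubic` are the
only definitions; no named fact is introduced (D-0026).  Next: the parametric splitting lemma and
the cusp normal form consume `c₃ ≠ 0` (third `x`-derivative) and 1-jet transversality (mixed
`tx`-derivative).

## References

* M. Golubitsky, V. Guillemin, *Stable Mappings and Their Singularities*, GTM 14 (1973): Ch. VI
  §2, Def. 2.3, Thm. 2.4, p. 147; §4; §5, Thm. 5.2. [GolubitskyGuillemin1973]
* R. İ. Baykur, O. Saeki, *Simplifying indefinite fibrations on 4-manifolds*, arXiv:1705.11169,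
  §2.1, p. 6. [BaykurSaeki2017]
-/

noncomputable section

set_option maxSynthPendingDepth 2

open Set Function Filter Module
open scoped ContDiff Topology

namespace Literature.Topology.FourManifolds

namespace OneJet

section

/-- Local notation for this file: the model space `ℝⁿ = EuclideanSpace ℝ (Fin n)`. -/
local notation "𝔼 " n:arg => EuclideanSpace ℝ (Fin n)

/-! ### The linear part of the chart of directions -/

/-- The linear part of the affine chart of directions: `radDir a yd = ∑ᵢ ydᵢ e_{a↑i}`, so that
`radVec a y = e_a + radDir a y`. [folklore] -/
def radDir (a : Fin 4) (yd : 𝔼 3) : 𝔼 4 :=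
  ∑ i : Fin 3, yd i • EuclideanSpace.single (a.succAbove i) (1 : ℝ)

/-- `radVec a y = e_a + radDir a y`. [folklore] -/
theorem radVec_eq_single_add_radDir (a : Fin 4) (y : 𝔼 3) :
    radVec a y = EuclideanSpace.single a (1 : ℝ) + radDir a y := rfl

/-- `(radDir a yd)_a = 0`. [folklore] -/
theorem radDir_apply_self (a : Fin 4) (yd : 𝔼 3) : radDir a yd a = 0 := by
  simp [radDir, Finset.sum_apply]

/-- `(radDir a yd)_{a↑i} = ydᵢ`. [folklore] -/
theorem radDir_apply_succAbove (a : Fin 4) (yd : 𝔼 3) (i : Fin 3) :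
    radDir a yd (a.succAbove i) = yd i := by
  simp [radDir, Finset.sum_apply, Pi.single_apply]

/-- `radDir a` is additive. [folklore] -/
theorem radDir_add (a : Fin 4) (yd yd' : 𝔼 3) : radDir a (yd + yd') = radDir a yd + radDir a yd' := by
  simp [radDir, add_smul, Finset.sum_add_distrib]

/-- `radDir a` is homogeneous. [folklore] -/
theorem radDir_smul (a : Fin 4) (s : ℝ) (yd : 𝔼 3) : radDir a (s • yd) = s • radDir a yd := by
  simp [radDir, Finset.smul_sum, smul_smul]

/-- `radDir a yd = 0` only for `yd = 0`. [folklore] -/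
theorem radDir_eq_zero_iff (a : Fin 4) (yd : 𝔼 3) : radDir a yd = 0 ↔ yd = 0 := by
  refine ⟨fun h => ?_, fun h => by rw [h, ← zero_smul ℝ (0 : 𝔼 3), radDir_smul, zero_smul]⟩
  ext i
  have := congrArg (fun w : 𝔼 4 => w (a.succAbove i)) h
  simpa [radDir_apply_succAbove] using this

/-- The chart of directions along a line: `radVec a (y + s yd) = radVec a y + s radDir a yd`.
[folklore] -/
theorem radVec_add_smul (a : Fin 4) (y yd : 𝔼 3) (s : ℝ) :
    radVec a (y + s • yd) = radVec a y + s • radDir a yd := by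
  rw [radVec_eq_single_add_radDir, radVec_eq_single_add_radDir, radDir_add, radDir_smul, add_assoc]

/-- A covector of `ℝ⁴` vanishing on `radVec a y` and on the `e_{a↑i}` vanishes. [folklore] -/
theorem eq_zero_of_apply_radVec_eq_zero (a : Fin 4) (y : 𝔼 3) {φ : 𝔼 4 →L[ℝ] ℝ}
    (hk : φ (radVec a y) = 0)
    (hW : ∀ i : Fin 3, φ (EuclideanSpace.single (a.succAbove i) (1 : ℝ)) = 0) : φ = 0 := by
  refine eq_zero_of_apply_single_succAbove a ?_ hW
  have h1 : φ (radDir a y) = 0 := by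
    simp only [radDir, map_sum, map_smul, hW, smul_zero, Finset.sum_const_zero]
  rw [radVec_eq_single_add_radDir, map_add, h1, add_zero] at hk
  exact hk

/-! ### The derivative of the system in the unknowns -/
set_option maxHeartbeats 400000 in -- buildfix (bf3-g27): 160k/180k FAIL, 200k PASS at accept time; line-neutral budget line
/-- **The system along a line in the unknowns is differentiable, with the expected derivative**:
for `u(s) = (x + sv, c + scd, y + syd, τ + sτd)`,
`d/ds G(u(s))|₀ = ( ℓ_c D²g(v,·) + cd ℓ_B dg ,`
` ℓ_c D³g(v,·,k) + cd ℓ_B D²g(·,k) + ℓ_c D²g(·,kd) + (τd ℓ_B dg + τ ℓ_B D²g(v,·)) ,`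
` ℓ_B D²g(v,k) + ℓ_B dg(kd) )` with `k = radVec a y`, `kd = radDir a yd`. [folklore] -/
theorem hasDerivAt_oneOneSystem_line {g : 𝔼 4 → 𝔼 2} {Ω : Set (𝔼 4)} (hΩ : IsOpen Ω)
    (hg : ContDiffOn ℝ ∞ g Ω) (ℓA ℓB : (𝔼 2) →L[ℝ] ℝ) (a : Fin 4) {x : 𝔼 4} (hx : x ∈ Ω)
    (c : ℝ) (y : 𝔼 3) (τ : ℝ) (v : 𝔼 4) (cd : ℝ) (yd : 𝔼 3) (τd : ℝ) :
    HasDerivAt (fun s : ℝ =>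
        oneOneSystem ℓA ℓB a g (x + s • v, (c + s * cd, (y + s • yd, τ + s * τd))))
      ((ℓA + c • ℓB).comp (fderiv ℝ (fderiv ℝ g) x v) + cd • ℓB.comp (fderiv ℝ g x),
        ((ℓA + c • ℓB).comp ((fderiv ℝ (fderiv ℝ (fderiv ℝ g)) x v).flip (radVec a y)) +
              cd • ℓB.comp ((fderiv ℝ (fderiv ℝ g) x).flip (radVec a y)) +
            (ℓA + c • ℓB).comp ((fderiv ℝ (fderiv ℝ g) x).flip (radDir a yd)) +
          (τd • ℓB.comp (fderiv ℝ g x) + τ • ℓB.comp (fderiv ℝ (fderiv ℝ g) x v)),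
          ℓB (fderiv ℝ (fderiv ℝ g) x v (radVec a y)) + ℓB (fderiv ℝ g x (radDir a yd)))) 0 := by
  -- the jets along the line
  have hg1 : ContDiffOn ℝ ∞ (fderiv ℝ g) Ω := hg.fderiv_of_isOpen hΩ (by simp)
  have hg2 : ContDiffOn ℝ ∞ (fderiv ℝ (fderiv ℝ g)) Ω := hg1.fderiv_of_isOpen hΩ (by simp)
  have hJ1 : HasFDerivAt (fderiv ℝ g) (fderiv ℝ (fderiv ℝ g) x) x :=
    ((hg1.contDiffAt (hΩ.mem_nhds hx)).differentiableAt (by simp)).hasFDerivAt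
  have hJ2 : HasFDerivAt (fderiv ℝ (fderiv ℝ g)) (fderiv ℝ (fderiv ℝ (fderiv ℝ g)) x) x :=
    ((hg2.contDiffAt (hΩ.mem_nhds hx)).differentiableAt (by simp)).hasFDerivAt
  have hxl : HasDerivAt (fun s : ℝ => x + s • v) v 0 := by
    simpa using ((hasDerivAt_id (0 : ℝ)).smul_const v).const_add x
  have hJ1l : HasDerivAt (fun s : ℝ => fderiv ℝ g (x + s • v)) (fderiv ℝ (fderiv ℝ g) x v) 0 :=
    hJ1.comp_hasDerivAt_of_eq 0 hxl (by simp)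
  have hJ2l : HasDerivAt (fun s : ℝ => fderiv ℝ (fderiv ℝ g) (x + s • v))
      (fderiv ℝ (fderiv ℝ (fderiv ℝ g)) x v) 0 :=
    hJ2.comp_hasDerivAt_of_eq 0 hxl (by simp)
  -- the affine data along the line
  have hcl : HasDerivAt (fun s : ℝ => c + s * cd) cd 0 := by
    simpa using ((hasDerivAt_id (0 : ℝ)).mul_const cd).const_add c
  have hℓl : HasDerivAt (fun s : ℝ => ℓA + (c + s * cd) • ℓB) (cd • ℓB) 0 :=
    (hcl.smul_const ℓB).const_add ℓA
  have hkl : HasDerivAt (fun s : ℝ => radVec a (y + s • yd)) (radDir a yd) 0 := by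
    have : (fun s : ℝ => radVec a (y + s • yd)) = fun s => radVec a y + s • radDir a yd := by
      funext s; exact radVec_add_smul a y yd s
    rw [this]
    simpa using ((hasDerivAt_id (0 : ℝ)).smul_const (radDir a yd)).const_add (radVec a y)
  have hτl : HasDerivAt (fun s : ℝ => τ + s * τd) τd 0 := by
    simpa using ((hasDerivAt_id (0 : ℝ)).mul_const τd).const_add τ
  -- flipping is linear
  have hflipl : HasDerivAt (fun s : ℝ => (fderiv ℝ (fderiv ℝ g) (x + s • v)).flip)
      (fderiv ℝ (fderiv ℝ (fderiv ℝ g)) x v).flip 0 := by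
    have h := (flipL (E := 𝔼 4) (F := 𝔼 2)).hasFDerivAt.comp_hasDerivAt (x := (0 : ℝ)) hJ2l
    simpa [Function.comp_def] using h
  -- the three components
  have h1 := hℓl.clm_comp hJ1l
  have h2 := ((hℓl.clm_comp (hflipl.clm_apply hkl)).add
    (hτl.smul ((hasDerivAt_const (0 : ℝ) ℓB).clm_comp hJ1l)))
  have h3 := (hasDerivAt_const (0 : ℝ) ℓB).clm_apply (hJ1l.clm_apply hkl)
  have key := h1.prodMk (h2.prodMk h3)
  -- compare with the system (definitional unfolding) and clean the value at `s = 0`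
  show HasDerivAt (fun s : ℝ =>
      ((ℓA + (c + s * cd) • ℓB).comp (fderiv ℝ g (x + s • v)),
        ((ℓA + (c + s * cd) • ℓB).comp
            ((fderiv ℝ (fderiv ℝ g) (x + s • v)).flip (radVec a (y + s • yd))) +
          (τ + s * τd) • ℓB.comp (fderiv ℝ g (x + s • v)),
        ℓB (fderiv ℝ g (x + s • v) (radVec a (y + s • yd)))))) _ 0
  refine key.congr_deriv ?_
  simp only [zero_smul, add_zero, zero_mul, zero_add, ContinuousLinearMap.zero_comp,
    _root_.zero_apply, Prod.mk.injEq]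
  refine ⟨?_, ?_, ?_⟩
  · ext w
    simp only [_root_.add_apply, ContinuousLinearMap.comp_apply, _root_.smul_apply, smul_eq_mul,
      ContinuousLinearMap.smul_comp]
    ring
  · ext w
    simp only [_root_.add_apply, ContinuousLinearMap.comp_apply, _root_.smul_apply, smul_eq_mul,
      ContinuousLinearMap.smul_comp, ContinuousLinearMap.flip_apply, map_add]
    ring
  · simp only [map_add]

/-- The system of a FIXED map is `C^∞` in the unknowns over `Ω`. [folklore] -/
theorem contDiffOn_oneOneSystem_right {g : 𝔼 4 → 𝔼 2} {Ω : Set (𝔼 4)} (hΩ : IsOpen Ω)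
    (hg : ContDiffOn ℝ ∞ g Ω) (ℓA ℓB : (𝔼 2) →L[ℝ] ℝ) (a : Fin 4) :
    ContDiffOn ℝ ∞ (oneOneSystem ℓA ℓB a g) (Ω ×ˢ univ) := by
  have h := contDiffOn_oneOneSystem hΩ hg ℓA ℓB a
  have hι : ContDiff ℝ ∞ fun u : Unknowns =>
      ((0 : (𝔼 4 →L[ℝ] 𝔼 2) × (𝔼 4 →L[ℝ] 𝔼 4 →L[ℝ] 𝔼 2)), u) :=
    contDiff_const.prodMk contDiff_id
  have hm : MapsTo (fun u : Unknowns => ((0 : (𝔼 4 →L[ℝ] 𝔼 2) × (𝔼 4 →L[ℝ] 𝔼 4 →L[ℝ] 𝔼 2)), u))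
      (Ω ×ˢ univ) (univ ×ˢ (Ω ×ˢ univ)) := fun u hu => ⟨mem_univ _, hu⟩
  have h' := h.comp hι.contDiffOn hm
  have heq : quadPerturb g (0 : (𝔼 4 →L[ℝ] 𝔼 2) × (𝔼 4 →L[ℝ] 𝔼 4 →L[ℝ] 𝔼 2)) = g := by
    funext z
    simp [quadPerturb]
  refine h'.congr fun u _ => ?_
  show oneOneSystem ℓA ℓB a g u =
    oneOneSystem ℓA ℓB a (quadPerturb g (0 : (𝔼 4 →L[ℝ] 𝔼 2) × (𝔼 4 →L[ℝ] 𝔼 4 →L[ℝ] 𝔼 2))) u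
  rw [heq]

/-- **The differential of the system in the unknowns**, applied to `u̇ = (v, ċ, ẏ, τ̇)`:
`D_uG(u̇) = ( ℓ_c D²g(v,·) + ċ ℓ_B dg , ℓ_c D³g(v,·,k) + ċ ℓ_B D²g(·,k) + ℓ_c D²g(·,k̇) + τ̇ ℓ_B dg +
τ ℓ_B D²g(v,·) , ℓ_B D²g(v,k) + ℓ_B dg(k̇) )`. [folklore] -/
theorem fderiv_oneOneSystem_apply {g : 𝔼 4 → 𝔼 2} {Ω : Set (𝔼 4)} (hΩ : IsOpen Ω)
    (hg : ContDiffOn ℝ ∞ g Ω) (ℓA ℓB : (𝔼 2) →L[ℝ] ℝ) (a : Fin 4) {x : 𝔼 4} (hx : x ∈ Ω)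
    (c : ℝ) (y : 𝔼 3) (τ : ℝ) (v : 𝔼 4) (cd : ℝ) (yd : 𝔼 3) (τd : ℝ) :
    fderiv ℝ (oneOneSystem ℓA ℓB a g) (x, (c, (y, τ))) (v, (cd, (yd, τd))) =
      ((ℓA + c • ℓB).comp (fderiv ℝ (fderiv ℝ g) x v) + cd • ℓB.comp (fderiv ℝ g x),
        ((ℓA + c • ℓB).comp ((fderiv ℝ (fderiv ℝ (fderiv ℝ g)) x v).flip (radVec a y)) +
              cd • ℓB.comp ((fderiv ℝ (fderiv ℝ g) x).flip (radVec a y)) +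
            (ℓA + c • ℓB).comp ((fderiv ℝ (fderiv ℝ g) x).flip (radDir a yd)) +
          (τd • ℓB.comp (fderiv ℝ g x) + τ • ℓB.comp (fderiv ℝ (fderiv ℝ g) x v)),
          ℓB (fderiv ℝ (fderiv ℝ g) x v (radVec a y)) + ℓB (fderiv ℝ g x (radDir a yd)))) := by
  have hG : HasFDerivAt (oneOneSystem ℓA ℓB a g)
      (fderiv ℝ (oneOneSystem ℓA ℓB a g) (x, (c, (y, τ)))) (x, (c, (y, τ))) :=
    (((contDiffOn_oneOneSystem_right hΩ hg ℓA ℓB a).contDiffAt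
      ((hΩ.prod isOpen_univ).mem_nhds ⟨hx, mem_univ _⟩)).differentiableAt (by simp)).hasFDerivAt
  have hline : HasDerivAt (fun s : ℝ => ((x, (c, (y, τ))) : Unknowns) + s • (v, (cd, (yd, τd))))
      ((v, (cd, (yd, τd))) : Unknowns) 0 := by
    simpa using ((hasDerivAt_id (0 : ℝ)).smul_const ((v, (cd, (yd, τd))) : Unknowns)).const_add
      ((x, (c, (y, τ))) : Unknowns)
  have h1 := hG.comp_hasDerivAt_of_eq 0 hline (by simp)
  have h2 := hasDerivAt_oneOneSystem_line hΩ hg ℓA ℓB a hx c y τ v cd yd τd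
  have heq : (oneOneSystem ℓA ℓB a g ∘ fun s : ℝ =>
      ((x, (c, (y, τ))) : Unknowns) + s • (v, (cd, (yd, τd)))) =
      fun s => oneOneSystem ℓA ℓB a g (x + s • v, (c + s * cd, (y + s • yd, τ + s * τd))) := by
    funext s
    simp only [Function.comp, Prod.smul_mk, Prod.mk_add_mk, smul_eq_mul]
  rw [heq] at h1
  exact h1.unique h2

/-! ### The invariant cubic and the kernel vector -/

/-- **The invariant cubic** of the system at `u = (x, c, y, τ)`:
`c₃(u) = ℓ_c(D³g(x)(k, k, k)) + 3τ ℓ_B(D²g(x)(k, k))`, `k = radVec a y`, `ℓ_c = ℓ_A + c ℓ_B`.  At a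
zero of the system it is unchanged under source diffeomorphisms (the corrections
`3 ℓ_c D²g(σ''(k,k), k) = -3τ ℓ_B dg(σ''(k,k))` and `3τ ℓ_B dg(σ''(k,k))` cancel), and in rank-one
fibred coordinates `g = (q₀, f)` it is a non-zero multiple of `∂³f/∂k³` — Whitney's /
Golubitsky–Guillemin's simple-cusp quantity `∂³h/∂x₂³` (GG VI Def. 2.3 and p. 147).
[cite: GolubitskyGuillemin1973, Ch. VI §2, Def. 2.3] -/
def cuspCubic (ℓA ℓB : (𝔼 2) →L[ℝ] ℝ) (a : Fin 4) (g : 𝔼 4 → 𝔼 2) (u : Unknowns) : ℝ :=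
  (ℓA + u.2.1 • ℓB) (fderiv ℝ (fderiv ℝ (fderiv ℝ g)) u.1 (radVec a u.2.2.1) (radVec a u.2.2.1)
      (radVec a u.2.2.1)) +
    3 * u.2.2.2 * ℓB (fderiv ℝ (fderiv ℝ g) u.1 (radVec a u.2.2.1) (radVec a u.2.2.1))

/-- Unfolding `cuspCubic` at `u = (x, (c, (y, τ)))`. [folklore] -/
theorem cuspCubic_apply (ℓA ℓB : (𝔼 2) →L[ℝ] ℝ) (a : Fin 4) (g : 𝔼 4 → 𝔼 2) (x : 𝔼 4) (c : ℝ)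
    (y : 𝔼 3) (τ : ℝ) :
    cuspCubic ℓA ℓB a g (x, (c, (y, τ))) =
      (ℓA + c • ℓB) (fderiv ℝ (fderiv ℝ (fderiv ℝ g)) x (radVec a y) (radVec a y) (radVec a y)) +
        3 * τ * ℓB (fderiv ℝ (fderiv ℝ g) x (radVec a y) (radVec a y)) :=
  rfl

/-- **The kernel vector** (linear algebra of the contrapositive).  Data: the jets `J₁, J₂, J₃(k)`
of `g` at `x` (`J₂` symmetric), the charts `ℓ_c = ℓ_A + c ℓ_B` (with `(ℓ_A, ℓ_B)` independent) and
`k = radVec a y`, a zero `(c, y, τ)` of the system, 1-jet transversality at `x` for the covector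
`ℓ_c`, and the vanishing of the cubic.  Then the `(ẏ, τ̇)`-equations
`ℓ_c D²g(e_{a↑i}, k̇) + τ̇ ℓ_B dg(e_{a↑i}) = -(ℓ_c D³g(k, e_{a↑i}, k) + 2τ ℓ_B D²g(k, e_{a↑i}))`,
`ℓ_B dg(k̇) = -ℓ_B D²g(k, k)` have a solution (their homogeneous system has only the trivial
solution by transversality, and it is square), and `(k, τ, ẏ, τ̇)` is then killed by the
differential of the system: all three blocks of `fderiv_oneOneSystem_apply` vanish. [folklore] -/
theorem exists_kernel_vector (ℓA ℓB : (𝔼 2) →L[ℝ] ℝ) (c τ : ℝ) (a : Fin 4) (y : 𝔼 3)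
    (J₁ : 𝔼 4 →L[ℝ] 𝔼 2) (J₂ : 𝔼 4 →L[ℝ] 𝔼 4 →L[ℝ] 𝔼 2) (J₃k : 𝔼 4 →L[ℝ] 𝔼 4 →L[ℝ] 𝔼 2)
    (hsymm : ∀ v w, J₂ v w = J₂ w v) (hspan : ∀ w : 𝔼 2, ℓA w = 0 → ℓB w = 0 → w = 0)
    (htr : ∀ κ : 𝔼 4, J₁ κ = 0 → (∀ v, (ℓA + c • ℓB) (J₂ v κ) = 0) → κ = 0)
    (hZ1 : (ℓA + c • ℓB).comp J₁ = 0)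
    (hZ2 : ∀ v, (ℓA + c • ℓB) (J₂ v (radVec a y)) = -(τ * ℓB (J₁ v)))
    (hZ3 : ℓB (J₁ (radVec a y)) = 0)
    (hc3 : (ℓA + c • ℓB) (J₃k (radVec a y) (radVec a y)) +
      3 * τ * ℓB (J₂ (radVec a y) (radVec a y)) = 0) :
    ∃ (yd : 𝔼 3) (τd : ℝ),
      (ℓA + c • ℓB).comp (J₂ (radVec a y)) + τ • ℓB.comp J₁ = 0 ∧
      (ℓA + c • ℓB).comp (J₃k.flip (radVec a y)) + τ • ℓB.comp (J₂.flip (radVec a y)) +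
            (ℓA + c • ℓB).comp (J₂.flip (radDir a yd)) +
          (τd • ℓB.comp J₁ + τ • ℓB.comp (J₂ (radVec a y))) = 0 ∧
      ℓB (J₂ (radVec a y) (radVec a y)) + ℓB (J₁ (radDir a yd)) = 0 := by
  set k : 𝔼 4 := radVec a y with hk
  set ℓc : (𝔼 2) →L[ℝ] ℝ := ℓA + c • ℓB with hℓc
  have hka : k a = 1 := radVec_apply_self a y
  -- consequences of the zero conditions
  have hcJ : ∀ w, ℓc (J₁ w) = 0 := fun w => by
    have := congrArg (fun φ : 𝔼 4 →L[ℝ] ℝ => φ w) hZ1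
    simpa using this
  have hAof : ∀ w : 𝔼 2, ℓA w = ℓc w - c * ℓB w := fun w => by
    simp only [hℓc, _root_.add_apply, _root_.smul_apply, smul_eq_mul]; ring
  have hker : ∀ w, ℓB (J₁ w) = 0 → J₁ w = 0 := fun w hw =>
    hspan _ (by rw [hAof, hcJ, hw, mul_zero, sub_zero]) hw
  have hJk : J₁ k = 0 := hker k hZ3
  -- the homogeneous `(ẏ, τ̇)`-system has only the trivial solution
  set M : (𝔼 3 × ℝ) →ₗ[ℝ] ((Fin 3 → ℝ) × ℝ) :=
    { toFun := fun p => (fun i => ℓc (J₂ (EuclideanSpace.single (a.succAbove i) (1 : ℝ))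
          (radDir a p.1)) + p.2 * ℓB (J₁ (EuclideanSpace.single (a.succAbove i) (1 : ℝ))),
        ℓB (J₁ (radDir a p.1)))
      map_add' := fun p q => by
        ext i
        · simp only [Prod.fst_add, Prod.snd_add, radDir_add, map_add, Pi.add_apply]; ring
        · simp only [Prod.fst_add, Prod.snd_add, radDir_add, map_add]
      map_smul' := fun s p => by
        ext i
        · simp only [Prod.smul_fst, Prod.smul_snd, radDir_smul, map_smul, smul_eq_mul,
            Pi.smul_apply, RingHom.id_apply]; ring
        · simp only [Prod.smul_fst, Prod.smul_snd, radDir_smul, map_smul, smul_eq_mul,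
            RingHom.id_apply] } with hM
  have hMinj : Function.Injective M := by
    refine (injective_iff_map_eq_zero M).2 ?_
    rintro ⟨yd, τd⟩ hp
    have hp1 : ∀ i : Fin 3, ℓc (J₂ (EuclideanSpace.single (a.succAbove i) (1 : ℝ))
        (radDir a yd)) + τd * ℓB (J₁ (EuclideanSpace.single (a.succAbove i) (1 : ℝ))) = 0 :=
      fun i => by
      have := congrArg Prod.fst hp
      simpa [hM] using congrFun this i
    have hp2 : ℓB (J₁ (radDir a yd)) = 0 := by
      have := congrArg Prod.snd hp
      simpa [hM] using this
    set κ : 𝔼 4 := radDir a yd with hκ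
    have hκK : J₁ κ = 0 := hker κ hp2
    -- `ψ := ℓ_c D²g(·, κ) + τ̇ ℓ_B dg` vanishes on `k` and on the `e_{a↑i}`, hence everywhere
    have hψ0 : ℓc.comp (J₂.flip κ) + τd • ℓB.comp J₁ = 0 := by
      refine eq_zero_of_apply_radVec_eq_zero a y ?_ fun i => ?_
      · show (ℓc.comp (J₂.flip κ) + τd • ℓB.comp J₁) k = 0
        simp only [_root_.add_apply, ContinuousLinearMap.comp_apply,
          ContinuousLinearMap.flip_apply, _root_.smul_apply, smul_eq_mul, hZ3, mul_zero,
          add_zero]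
        rw [hsymm k κ, hZ2 κ, hp2, mul_zero, neg_zero]
      · simp only [_root_.add_apply, ContinuousLinearMap.comp_apply,
          ContinuousLinearMap.flip_apply, _root_.smul_apply, smul_eq_mul]
        exact hp1 i
    have hψ : ∀ w, ℓc (J₂ w κ) + τd * ℓB (J₁ w) = 0 := fun w => by
      have := congrArg (fun φ : 𝔼 4 →L[ℝ] ℝ => φ w) hψ0
      simpa using this
    -- `τ̇ k - τ κ` is killed by `ℓ_c D²g(·, -)` and lies in `Ker dg`: it vanishes
    have hκ' : τd • k - τ • κ = 0 := by
      refine htr _ ?_ fun w => ?_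
      · rw [map_sub, map_smul, map_smul, hJk, hκK, smul_zero, smul_zero, sub_zero]
      · have h1 := hZ2 w
        have h2 := hψ w
        rw [map_sub, map_smul, map_smul, map_sub, map_smul, map_smul, smul_eq_mul, smul_eq_mul,
          h1]
        linear_combination (-τ) * h2
    have hτd : τd = 0 := by
      have := congrArg (fun w : 𝔼 4 => w a) hκ'
      simpa [hka, hκ, radDir_apply_self] using this
    have hκ0 : κ = 0 := htr κ hκK fun w => by
      have := hψ w
      rwa [hτd, zero_mul, add_zero] at this
    have hyd : yd = 0 := (radDir_eq_zero_iff a yd).1 hκ0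
    simp [hyd, hτd]
  -- hence it is onto: solve for `(ẏ, τ̇)`
  have hdim : finrank ℝ (𝔼 3 × ℝ) = finrank ℝ ((Fin 3 → ℝ) × ℝ) := by simp
  have hMsurj : Function.Surjective M :=
    (LinearMap.injective_iff_surjective_of_finrank_eq_finrank hdim).1 hMinj
  obtain ⟨⟨yd, τd⟩, hsol⟩ := hMsurj
    (fun i => -(ℓc (J₃k (EuclideanSpace.single (a.succAbove i) (1 : ℝ)) k) +
        2 * τ * ℓB (J₂ k (EuclideanSpace.single (a.succAbove i) (1 : ℝ)))),
      -ℓB (J₂ k k))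
  have hs1 : ∀ i : Fin 3, ℓc (J₂ (EuclideanSpace.single (a.succAbove i) (1 : ℝ)) (radDir a yd)) +
      τd * ℓB (J₁ (EuclideanSpace.single (a.succAbove i) (1 : ℝ))) =
      -(ℓc (J₃k (EuclideanSpace.single (a.succAbove i) (1 : ℝ)) k) +
        2 * τ * ℓB (J₂ k (EuclideanSpace.single (a.succAbove i) (1 : ℝ)))) := fun i => by
    have := congrArg Prod.fst hsol
    simpa [hM] using congrFun this i
  have hs2 : ℓB (J₁ (radDir a yd)) = -ℓB (J₂ k k) := by
    have := congrArg Prod.snd hsol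
    simpa [hM] using this
  refine ⟨yd, τd, ?_, ?_, ?_⟩
  · -- block 1: the zero condition and the symmetry of `D²g`
    ext w
    simp only [_root_.add_apply, ContinuousLinearMap.comp_apply, _root_.smul_apply, smul_eq_mul,
      _root_.zero_apply]
    rw [hsymm k w, hZ2 w]
    ring
  · -- block 2: on the `e_{a↑i}` by the choice of `(ẏ, τ̇)`, on `k` by the vanishing cubic
    refine eq_zero_of_apply_radVec_eq_zero a y ?_ fun i => ?_
    · show (ℓc.comp (J₃k.flip k) + τ • ℓB.comp (J₂.flip k) + ℓc.comp (J₂.flip (radDir a yd)) +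
        (τd • ℓB.comp J₁ + τ • ℓB.comp (J₂ k))) k = 0
      simp only [_root_.add_apply, ContinuousLinearMap.comp_apply,
        ContinuousLinearMap.flip_apply, _root_.smul_apply, smul_eq_mul, hZ3, mul_zero, zero_add]
      rw [hsymm k (radDir a yd), hZ2 (radDir a yd), hs2]
      nlinarith [hc3]
    · simp only [_root_.add_apply, ContinuousLinearMap.comp_apply,
        ContinuousLinearMap.flip_apply, _root_.smul_apply, smul_eq_mul]
      rw [hsymm (EuclideanSpace.single (a.succAbove i) (1 : ℝ)) k]
      linear_combination hs1 i
  · -- block 3: the choice of `ẏ`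
    rw [hs2]
    ring

/-- **At a nondegenerate zero of the incidence system the invariant cubic does not vanish**
(the genericity of `OneOneTransversality.ae_surjective_fderiv_oneOneSystem` IS the simple-cusp
condition, GG VI Def. 2.3: "the function `k|_{S₁(f)}` has a simple zero", in 4-space `∂³h/∂x³ ≠ 0`
for the Morin cusp `(t, x³ + tx ± y² ± z²)`).  Hypotheses: `g` is `C^∞` on the open `Ω ∋ x`
and 1-jet-transverse at `x`; `(ℓ_A, ℓ_B)` is a basis of `(ℝ²)*` (`ℓ_A(u_A) = 1`,
`ℓ_B(u_A) = 0`, common kernel zero); `u = (x, c, y, τ)` is a zero of the system with `D_uG` onto.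
Proof: if `c₃(u) = 0`, `exists_kernel_vector` and `fderiv_oneOneSystem_apply` produce a non-zero
kernel vector of the square matrix `D_uG`. [cite: GolubitskyGuillemin1973, Ch. VI §2, Def. 2.3; §4] -/
theorem cuspCubic_ne_zero_of_surjective {g : 𝔼 4 → 𝔼 2} {Ω : Set (𝔼 4)} (hΩ : IsOpen Ω)
    (hg : ContDiffOn ℝ ∞ g Ω) {ℓA ℓB : (𝔼 2) →L[ℝ] ℝ} {uA : 𝔼 2} (hA1 : ℓA uA = 1)
    (hB1 : ℓB uA = 0) (hspan : ∀ w : 𝔼 2, ℓA w = 0 → ℓB w = 0 → w = 0) (a : Fin 4)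
    {x : 𝔼 4} (hx : x ∈ Ω) {c : ℝ} {y : 𝔼 3} {τ : ℝ} (htr : IsOneJetTransverseAt g x)
    (h0 : oneOneSystem ℓA ℓB a g (x, (c, (y, τ))) = 0)
    (hsurj : Surjective (fderiv ℝ (oneOneSystem ℓA ℓB a g) (x, (c, (y, τ))))) :
    cuspCubic ℓA ℓB a g (x, (c, (y, τ))) ≠ 0 := by
  intro hc3
  obtain ⟨hZ1, hZ2, hZ3⟩ := (oneOneSystem_eq_zero_iff ℓA ℓB a g x c y τ).1 h0
  have hsymm : IsSymmSndFDerivAt ℝ g x :=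
    (hg.contDiffAt (hΩ.mem_nhds hx)).isSymmSndFDerivAt
      (by simp only [minSmoothness_of_isRCLikeNormedField]; exact CerfPath.two_le_infty)
  have hℓc0 : ℓA + c • ℓB ≠ 0 := fun h => by
    have := congrArg (fun φ : (𝔼 2) →L[ℝ] ℝ => φ uA) h
    simp [hA1, hB1] at this
  have htr' : ∀ κ : 𝔼 4, fderiv ℝ g x κ = 0 →
      (∀ v, (ℓA + c • ℓB) (fderiv ℝ (fderiv ℝ g) x v κ) = 0) → κ = 0 :=
    fun κ hκ hv => htr (ℓA + c • ℓB) hℓc0 hZ1 κ hκ hv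
  rw [cuspCubic_apply] at hc3
  obtain ⟨yd, τd, hb1, hb2, hb3⟩ := exists_kernel_vector ℓA ℓB c τ a y (fderiv ℝ g x)
    (fderiv ℝ (fderiv ℝ g) x) (fderiv ℝ (fderiv ℝ (fderiv ℝ g)) x (radVec a y))
    (fun v w => hsymm v w) hspan htr' hZ1 hZ2 hZ3 hc3
  -- the kernel vector
  have hDU : fderiv ℝ (oneOneSystem ℓA ℓB a g) (x, (c, (y, τ)))
      (radVec a y, (τ, (yd, τd))) = 0 := by
    rw [fderiv_oneOneSystem_apply hΩ hg ℓA ℓB a hx c y τ (radVec a y) τ yd τd, hb1, hb2, hb3]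
    rfl
  -- `D_uG` is square and onto, hence injective
  have hdim : finrank ℝ Unknowns = finrank ℝ Values := by
    simp [Unknowns, Values, Module.finrank_prod, finrank_continuousLinearMap_real]
  have hinj : Injective (fderiv ℝ (oneOneSystem ℓA ℓB a g) (x, (c, (y, τ)))) :=
    (LinearMap.injective_iff_surjective_of_finrank_eq_finrank hdim
      (f := ((fderiv ℝ (oneOneSystem ℓA ℓB a g) (x, (c, (y, τ))) : Unknowns →L[ℝ] Values) :
        Unknowns →ₗ[ℝ] Values))).2 hsurj
  have hU : ((radVec a y, (τ, (yd, τd))) : Unknowns) = 0 :=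
    hinj (by rw [hDU, map_zero])
  have hk : radVec a y = 0 := congrArg Prod.fst hU
  have := congrArg (fun w : 𝔼 4 => w a) hk
  simp [radVec_apply_self] at this

/-! ### Every cusp candidate is a zero of one of the eight systems -/

/-- `(radVec a y)_{a↑i} = yᵢ`. [folklore] -/
theorem radVec_apply_succAbove (a : Fin 4) (y : 𝔼 3) (i : Fin 3) :
    radVec a y (a.succAbove i) = y i := by
  rw [radVec_eq_single_add_radDir, PiLp.add_apply, radDir_apply_succAbove, PiLp.single_apply,
    if_neg (Fin.succAbove_ne a i), zero_add]

/-- A non-zero vector of `ℝ⁴` is a multiple of a chart direction: `k₀ = (k₀)_a radVec a y` with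
`yᵢ = (k₀)_{a↑i} / (k₀)_a` for any `a` with `(k₀)_a ≠ 0`. [folklore] -/
theorem exists_radVec_eq_smul {k₀ : 𝔼 4} (hk₀ : k₀ ≠ 0) :
    ∃ (a : Fin 4) (y : 𝔼 3), k₀ a ≠ 0 ∧ radVec a y = (k₀ a)⁻¹ • k₀ := by
  have ha : ∃ a, k₀ a ≠ 0 := by
    by_contra h
    push Not at h
    exact hk₀ (PiLp.ext fun a => by simpa using h a)
  obtain ⟨a, ha⟩ := ha
  refine ⟨a, ∑ i : Fin 3, ((k₀ a)⁻¹ * k₀ (a.succAbove i)) • EuclideanSpace.single i (1 : ℝ), ha,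
    ?_⟩
  refine PiLp.ext fun j => ?_
  rcases Fin.eq_self_or_eq_succAbove a j with rfl | ⟨i, rfl⟩
  · rw [radVec_apply_self, PiLp.smul_apply, smul_eq_mul, inv_mul_cancel₀ ha]
  · rw [radVec_apply_succAbove, PiLp.smul_apply, smul_eq_mul]
    simp [Finset.sum_apply, Pi.single_apply]

/-- A non-zero covector of `ℝ²` is a multiple of a chart covector: `ℓ = ℓ(eᵢ) (eᵢ* + c e_{i+1}*)`
with `c = ℓ(e_{i+1}) / ℓ(eᵢ)` for any `i` with `ℓ(eᵢ) ≠ 0`. [folklore] -/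
theorem exists_proj_add_smul_proj_eq_smul {ℓ : (𝔼 2) →L[ℝ] ℝ} (hℓ : ℓ ≠ 0) :
    ∃ (i : Fin 2) (c : ℝ), ℓ (EuclideanSpace.single i (1 : ℝ)) ≠ 0 ∧
      (EuclideanSpace.proj i : (𝔼 2) →L[ℝ] ℝ) + c • EuclideanSpace.proj (i + 1) =
        (ℓ (EuclideanSpace.single i (1 : ℝ)))⁻¹ • ℓ := by
  have hexp : ∀ w : 𝔼 2, w = (w 0) • EuclideanSpace.single (0 : Fin 2) (1 : ℝ) +
      (w 1) • EuclideanSpace.single (1 : Fin 2) (1 : ℝ) := fun w => by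
    ext j; fin_cases j <;> simp
  have hi : ∃ i : Fin 2, ℓ (EuclideanSpace.single i (1 : ℝ)) ≠ 0 := by
    by_contra h
    push Not at h
    refine hℓ (ContinuousLinearMap.ext fun w => ?_)
    rw [hexp w, map_add, map_smul, map_smul, h 0, h 1]
    simp
  obtain ⟨i, hi⟩ := hi
  refine ⟨i, ℓ (EuclideanSpace.single (i + 1) (1 : ℝ)) / ℓ (EuclideanSpace.single i (1 : ℝ)), hi,
    ContinuousLinearMap.ext fun w => ?_⟩
  rw [hexp w]
  fin_cases i <;>
  · simp only [Fin.zero_eta, Fin.mk_one, Fin.isValue] at hi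
    simp only [_root_.add_apply, _root_.smul_apply, map_add, map_smul, smul_eq_mul]
    simp
    field_simp

/-- **Every cusp candidate is a zero of one of the eight incidence systems.**  Let `x` be a
critical point of `g` of rank one (`dg_x ≠ 0`, cokernel covector `ℓ ≠ 0`) and `k₀ ≠ 0` a
kernel vector in the radical of the kernel Hessian (`ℓ(D²g(x)(w, k₀)) = 0` for all
`w ∈ Ker dg_x`).  Then for the charts `a` (with `(k₀)_a ≠ 0`), `i` (with `ℓ(eᵢ) ≠ 0`),
`c = ℓ(e_{i+1})/ℓ(eᵢ)`, `y` (with `radVec a y ∥ k₀`) and a (unique) multiplier `τ`, the point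
`(x, c, y, τ)` is a zero of `oneOneSystem eᵢ* e_{i+1}* a g` (the functional `ℓ_c D²g(·, k)` vanishes
on the hyperplane `Ker dg_x = Ker (e_{i+1}* ∘ dg_x)`, so it is a multiple of `e_{i+1}* ∘ dg_x`).
[cite: GolubitskyGuillemin1973, Ch. VI §4] -/
theorem exists_chart_zero_of_radical {g : 𝔼 4 → 𝔼 2} {x : 𝔼 4} {ℓ : (𝔼 2) →L[ℝ] ℝ}
    (hℓ : ℓ ≠ 0) (hℓg : ℓ.comp (fderiv ℝ g x) = 0) (hne : fderiv ℝ g x ≠ 0) {k₀ : 𝔼 4}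
    (hk₀ : k₀ ≠ 0) (hk₀K : fderiv ℝ g x k₀ = 0)
    (hrad : ∀ w, fderiv ℝ g x w = 0 → ℓ (fderiv ℝ (fderiv ℝ g) x w k₀) = 0) :
    ∃ (a : Fin 4) (i : Fin 2) (c : ℝ) (y : 𝔼 3) (τ : ℝ),
      k₀ a ≠ 0 ∧ radVec a y = (k₀ a)⁻¹ • k₀ ∧ ℓ (EuclideanSpace.single i (1 : ℝ)) ≠ 0 ∧
      (EuclideanSpace.proj i : (𝔼 2) →L[ℝ] ℝ) + c • EuclideanSpace.proj (i + 1) =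
        (ℓ (EuclideanSpace.single i (1 : ℝ)))⁻¹ • ℓ ∧
      oneOneSystem (EuclideanSpace.proj i) (EuclideanSpace.proj (i + 1)) a g (x, (c, (y, τ)))
        = 0 := by
  obtain ⟨a, y, ha, hy⟩ := exists_radVec_eq_smul hk₀
  obtain ⟨i, c, hi, hc⟩ := exists_proj_add_smul_proj_eq_smul hℓ
  set J₁ := fderiv ℝ g x with hJ₁
  set J₂ := fderiv ℝ (fderiv ℝ g) x with hJ₂
  set ℓc : (𝔼 2) →L[ℝ] ℝ := (EuclideanSpace.proj i : (𝔼 2) →L[ℝ] ℝ) +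
    c • EuclideanSpace.proj (i + 1) with hℓc
  set ℓB : (𝔼 2) →L[ℝ] ℝ := EuclideanSpace.proj (i + 1) with hℓB
  set k := radVec a y with hk
  -- (Z1): `ℓ_c` kills the image
  have hZ1 : ℓc.comp J₁ = 0 := by
    rw [hc, ContinuousLinearMap.smul_comp, hℓg, smul_zero]
  have hcJ : ∀ v, ℓc (J₁ v) = 0 := fun v => by
    have := congrArg (fun φ : 𝔼 4 →L[ℝ] ℝ => φ v) hZ1
    simpa using this
  -- a vector of `ℝ²` killed by `ℓ_c` and `ℓ_B` vanishes
  have hspan : ∀ w : 𝔼 2, ℓc w = 0 → ℓB w = 0 → w = 0 := fun w h1 h2 => by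
    have hwi : w i = 0 := by
      have : ℓc w = w i + c * w (i + 1) := by simp [hℓc, hℓB]
      have h2' : w (i + 1) = 0 := by simpa [hℓB] using h2
      rw [this, h2', mul_zero, add_zero] at h1
      exact h1
    have hwi1 : w (i + 1) = 0 := by simpa [hℓB] using h2
    ext j
    fin_cases i <;> fin_cases j <;> simp_all
  have hker : ∀ v, ℓB (J₁ v) = 0 → J₁ v = 0 := fun v hv => hspan _ (hcJ v) hv
  -- `ℓ_B ∘ dg_x ≠ 0`: otherwise `dg_x = 0`
  have hv₀ : ∃ v₀, ℓB (J₁ v₀) ≠ 0 := by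
    by_contra h
    push Not at h
    exact hne (ContinuousLinearMap.ext fun v => by simpa using hker v (h v))
  obtain ⟨v₀, hv₀⟩ := hv₀
  -- the multiplier
  set τ : ℝ := -(ℓc (J₂ v₀ k)) / ℓB (J₁ v₀) with hτ
  have hradk : ∀ w, J₁ w = 0 → ℓc (J₂ w k) = 0 := fun w hw => by
    rw [hy, map_smul, hc, _root_.smul_apply, map_smul, hrad w hw, smul_eq_mul, smul_eq_mul,
      mul_zero, mul_zero]
  have hZ2 : ∀ v, ℓc (J₂ v k) = -(τ * ℓB (J₁ v)) := fun v => by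
    -- split `v` along `v₀` modulo the hyperplane `Ker dg_x`
    set r : ℝ := ℓB (J₁ v) / ℓB (J₁ v₀) with hr
    have hK : J₁ (v - r • v₀) = 0 := hker _ (by
      rw [map_sub, map_smul, map_sub, map_smul, smul_eq_mul, hr, div_mul_cancel₀ _ hv₀, sub_self])
    have h1 : ℓc (J₂ (v - r • v₀) k) = 0 := hradk _ hK
    rw [map_sub, map_smul, _root_.sub_apply, _root_.smul_apply, map_sub, map_smul, smul_eq_mul,
      sub_eq_zero] at h1
    rw [h1, hτ, hr]
    field_simp
  have hZ3 : ℓB (J₁ k) = 0 := by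
    rw [hy, map_smul, hk₀K, smul_zero, map_zero]
  refine ⟨a, i, c, y, τ, ha, hy, hi, hc, ?_⟩
  exact (oneOneSystem_eq_zero_iff _ _ a g x c y τ).2 ⟨hZ1, hZ2, hZ3⟩

/-- **Generic maps have simple cusps** — the form in which the two genericity theorems are
consumed: if `g` is 1-jet-transverse at the rank-one critical point `x` with cokernel covector
`ℓ`, all eight incidence systems of `g` have only nondegenerate zeros at `x`
(`OneOneTransversality.ae_twoGeneric_quadPerturb`), and `k₀ ≠ 0` spans the radical of the
kernel Hessian, then in the chart through `(ℓ, k₀)` the invariant cubic is non-zero.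
[cite: GolubitskyGuillemin1973, Ch. VI §2, Def. 2.3; §5, Thm. 5.2] [cite: BaykurSaeki2017, §2.1, p. 6] -/
theorem exists_chart_cuspCubic_ne_zero {g : 𝔼 4 → 𝔼 2} {Ω : Set (𝔼 4)} (hΩ : IsOpen Ω)
    (hg : ContDiffOn ℝ ∞ g Ω) {x : 𝔼 4} (hx : x ∈ Ω) (htr : IsOneJetTransverseAt g x)
    (hgen : ∀ a : Fin 4, ∀ i : Fin 2, ∀ (c : ℝ) (y : 𝔼 3) (τ : ℝ),
      oneOneSystem (EuclideanSpace.proj i) (EuclideanSpace.proj (i + 1)) a g (x, (c, (y, τ)))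
          = 0 →
        Surjective (fderiv ℝ (oneOneSystem (EuclideanSpace.proj i)
          (EuclideanSpace.proj (i + 1)) a g) (x, (c, (y, τ)))))
    {ℓ : (𝔼 2) →L[ℝ] ℝ} (hℓ : ℓ ≠ 0) (hℓg : ℓ.comp (fderiv ℝ g x) = 0) (hne : fderiv ℝ g x ≠ 0)
    {k₀ : 𝔼 4} (hk₀ : k₀ ≠ 0) (hk₀K : fderiv ℝ g x k₀ = 0)
    (hrad : ∀ w, fderiv ℝ g x w = 0 → ℓ (fderiv ℝ (fderiv ℝ g) x w k₀) = 0) :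
    ∃ (a : Fin 4) (i : Fin 2) (c : ℝ) (y : 𝔼 3) (τ : ℝ),
      k₀ a ≠ 0 ∧ radVec a y = (k₀ a)⁻¹ • k₀ ∧ ℓ (EuclideanSpace.single i (1 : ℝ)) ≠ 0 ∧
      (EuclideanSpace.proj i : (𝔼 2) →L[ℝ] ℝ) + c • EuclideanSpace.proj (i + 1) =
        (ℓ (EuclideanSpace.single i (1 : ℝ)))⁻¹ • ℓ ∧
      oneOneSystem (EuclideanSpace.proj i) (EuclideanSpace.proj (i + 1)) a g (x, (c, (y, τ)))
        = 0 ∧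
      cuspCubic (EuclideanSpace.proj i) (EuclideanSpace.proj (i + 1)) a g (x, (c, (y, τ))) ≠ 0 := by
  obtain ⟨a, i, c, y, τ, ha, hy, hi, hc, h0⟩ :=
    exists_chart_zero_of_radical hℓ hℓg hne hk₀ hk₀K hrad
  refine ⟨a, i, c, y, τ, ha, hy, hi, hc, h0, ?_⟩
  have hch := proj_single_two
  refine cuspCubic_ne_zero_of_surjective hΩ hg (uA := EuclideanSpace.single i (1 : ℝ))
    (by rw [hch, if_pos rfl]) (by rw [hch, if_neg]; fin_cases i <;> decide) ?_ a hx htr h0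
    (hgen a i c y τ h0)
  intro w h1 h2
  ext j
  have hwi : w i = 0 := by simpa using h1
  have hwi1 : w (i + 1) = 0 := by simpa using h2
  fin_cases i <;> fin_cases j <;> simp_all

end

end OneJet

end Literature.Topology.FourManifolds
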